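import Summits.ResolutionOfSingularities.ResolutionOfSingularities.Theorems.FrobeniusLadderFInjectiveMacaulayficationTrOfResolutionFull
import Summits.ResolutionOfSingularities.ResolutionOfSingularities.Theorems.FrobeniusLadderFInjectiveMacaulayficationFTemkinClosedPointsAdm
import Summits.ResolutionOfSingularities.ResolutionOfSingularities.Theorems.FrobeniusLadderFInjectiveMacaulayficationGermOfGlobalBlowup
import HarnessLib

/-!
# THE CALIBRATION BOTH WAYS: `ResolutionTr p e r` ⟺ `ClosedPointLocalResolutionAdmTr p e r` modulo the threefold package and the lower rungs
# (crux `FInjectiveMacaulayfication` stmt-ResolutionOfSingularities-15315, chain w45a; res-L1-w45a-plan-1 RULING R18.2 (1) «the memo writes ≡ only with the converse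
# cited BY NAME from the tree»; object O4 of res-L1-w45a-stub-3 g9, over `TrOfResolution` p612760 / `TrOfResolutionFull` p613542)

[OURS · L1 W4.5a] Support file (`--supports stmt-ResolutionOfSingularities-15315 --as helper`); replaces the role of NO printed item; NOT a statement of any
manuscript; def-free; CONDITIONAL only on the three printed theorems of the threefold package BY NAME (`CossartPiltant2019General`, `Stacks081R`,
`CossartPiltant2019Principalization`) where said. AI-written (AI review is weaker than expert review).

WHAT. `TrOfResolution` (p612760) proved T(p,e,r) ⟸ `ResolutionTr p e r` (Temkin 2008 Prop. 2.3.4 (ii)⇒(iii), localized). This file proves the converse for ONE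
`e`-fold at a time — Temkin's (iii)⇒(ii) PER VARIETY with conclusion REGULAR at every point:
* §1 ★ `admitsDesingularization_of_regularOffFinite_of_localRes` — THE CLOSED-POINT FINISHING ENGINE WITH CONCLUSION REGULAR (the one engine the chain did not have:
  its closed-point engines `FTemkinClosedPoints*` conclude FULL). Input: an integral variety `X/k`, a `Sing X`-supported blowing up `X′ → X` regular off the preimage
  of finitely many closed points (THEOREM A / `DimSlice.regularOffFinite_of_rungs`), and AT EACH CLOSED SINGULAR `b` Temkin's condition (iii) for ADMISSIBLE centres:
  every blowing up `S′ → Spec 𝒪_{X,b}` along a `Sing`-supported centre whose singular points lie on the closed fibre admits a desingularization (= the body of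
  `ClosedPointLocalResolutionAdmTr`). Output: `Scheme.AdmitsDesingularization X`. Proof = res-L1-w45a-stub-2's `FTemkinClosedPointsAdm.full_model_of_regularOffFinite_of_localAdm`
  (p5915xx) with «regular» for «FULL»: Finset induction over the bad closed points; at `b` the local model `X′ ×_X Spec 𝒪_{X,b}` is an admissible blowing up regular
  off the closed fibre (flat base change, `support_comap_fromSpecStalk_subset`); its desingularization `S″ → S′` (hypothesis) has a centre `𝓚 ⊆ Sing S′`, hence
  FIBRE-SUPPORTED; extend `𝓚` to `X′` (Temkin Lemma 2.1.1), blow up, compose (Lemma 2.1.4 / Stacks 080B); over `b` the new model is `X″ ×_{X′} S′ ≅ S″` (flat base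
  change + `IsBlowup.unique`), regular; elsewhere nothing changed (`IsBlowup.isIso_compl`).
* §2 ★★ `resolutionTr_of_tr (h4 : 4 ≤ e) (hG h081R hP) (hRlt : ∀ e′ r′, 4 ≤ e′ → e′ + 1 ≤ e → 1 ≤ r′ → T p e′ r′) (hT : T p e r) : ResolutionTr p e r`
  (non-closed points: `DimSlice.regularOffFinite_of_rungs`; closed points: §1 fed with T(p,e,r) at the field `k(X₁,…,X_r)` itself) and the calibration
  ★★★ **`resolutionTr_iff_tr (h4) (hG h081R hP) (hRlt) : ResolutionTr p e r ↔ ClosedPointLocalResolutionAdmTr p e r`**, in particular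
  **`resolutionTr_four_iff_tr_four (hG h081R hP) : ResolutionTr p 4 r ↔ ClosedPointLocalResolutionAdmTr p 4 r`** (no lower rung is consumed at `e = 4`) and the
  family form `forall_resolutionTr_iff_forall_tr`: **door v38's resolution stub IS resolution (Temkin's one-blow-up form) of `e`-folds over `k(X₁,…,X_r)`, `e ≥ 4`,
  `r ≥ 1`, modulo {CP 1.1, 081R, CP 4.4}** — the wording fact res-L1-w45a-plan-1 asked for (R18.2 (1)): T is of RESOLUTION strength.
[folklore assembly; cite: Temkin2008, §2.1 Lemma 2.1.1, Lemma 2.1.4, Def. 2.2.6, Prop. 2.3.4] [cite: StacksProject, Tag 080B; Tag 01J7; Tag 02OS]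
[cite: CossartPiltant2019, Thm. 1.1 (i)(ii); Prop. 4.4] [cite: RaynaudGruson1971, Thm. 5.2.2] [cite: GortzWedhorn2020, Prop. 13.91; (13.19)]
-/

-- single-problem summit: the doubled namespace component is forced
set_option linter.dupNamespace false

noncomputable section

namespace Summit.ResolutionOfSingularities.ResolutionOfSingularities.Theorems.FInjectiveMacaulayfication.ResolutionOfTr

open CategoryTheory CategoryTheory.Limits AlgebraicGeometry TopologicalSpace IsLocalRing Order
open Literature.AlgebraicGeometry.Resolution
open Summit.ResolutionOfSingularities.ResolutionOfSingularities.Theorems.FInjectiveMacaulayfication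
open ClosedPointLocalResolutionAdmTr TrOfResolution FTemkinClosedPoints

/-! ## §1 The closed-point finishing engine with conclusion REGULAR -/

-- adapted from res-L1-w45a-stub-2's `FTemkinClosedPointsAdm.full_model_of_regularOffFinite_of_localAdm`: same induction, «regular» for «FULL»
set_option maxHeartbeats 1600000 in
-- long: one Temkin step (flat base change, local desingularization, extension, composite, uniqueness) inside a Finset induction
/-- ★ **THE CLOSED-POINT FINISHING ENGINE WITH CONCLUSION REGULAR** (Temkin 2008 Prop. 2.3.4 (iii)⇒(ii), the closed-point steps, per variety). `X/k` an integral variety;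
`f : X′ → X` a blowing up along `J` with `Supp J ⊆ Sing X`, regular off the preimage of a finite set `F` of closed points; `hloc` = Temkin's condition (iii) at every
CLOSED SINGULAR point `b` for ADMISSIBLE centres (every blowing up `S′ → Spec 𝒪_{X,b}` along a `Sing`-supported centre whose singular points lie on the closed fibre
admits a desingularization — the body of `ClosedPointLocalResolutionAdmTr`). Then `X` admits a desingularization: ONE blowing up with centre in `Sing X` and regular
source. [folklore; cite: Temkin2008, Prop. 2.3.4, Lemma 2.1.1, Lemma 2.1.4] [cite: StacksProject, Tag 080B] -/
theorem admitsDesingularization_of_regularOffFinite_of_localRes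
    {k : Type} [Field k] (X : Scheme.{0}) (f₀ : X ⟶ Spec (.of k))
    [IsSeparated f₀] [LocallyOfFiniteType f₀] [QuasiCompact f₀] [IsIntegral X]
    (hloc : ∀ b : X, IsClosed ({b} : Set X) → b ∉ Scheme.regularLocus X →
      ∀ (S' : Scheme.{0}) (g : S' ⟶ Spec (X.presheaf.stalk b)) (I : (Spec (X.presheaf.stalk b)).IdealSheafData),
      IsBlowup g I → ((I.support : Set (Spec (X.presheaf.stalk b))) ⊆ (Scheme.regularLocus (Spec (X.presheaf.stalk b)))ᶜ) →
      (∀ s : S', s ∉ Scheme.regularLocus S' → g.base s = closedPoint (X.presheaf.stalk b)) →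
      Scheme.AdmitsDesingularization S')
    (X' : Scheme.{0}) (f : X' ⟶ X) (J : X.IdealSheafData) (hf : IsBlowup f J)
    (hJ : (J.support : Set X) ⊆ (Scheme.regularLocus X)ᶜ)
    (F : Finset X) (hFcl : ∀ b ∈ F, IsClosed ({b} : Set X)) (hreg : ∀ x' : X', f x' ∉ F → x' ∈ Scheme.regularLocus X') :
    Scheme.AdmitsDesingularization X := by
  classical
  haveI : IsLocallyNoetherian X := LocallyOfFiniteType.isLocallyNoetherian f₀
  haveI : CompactSpace X := QuasiCompact.compactSpace_of_compactSpace f₀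
  haveI : IsNoetherian X := {}
  set T : Set X := (Scheme.regularLocus X)ᶜ with hT
  -- `J ≠ ⊥` for every `T`-supported centre
  have hne_of_supp : ∀ J₁ : X.IdealSheafData, (J₁.support : Set X) ⊆ T → J₁ ≠ ⊥ := by
    intro J₁ hJ₁ h0
    have hgen : genericPoint X ∈ (J₁.support : Set X) := by rw [h0, Scheme.IdealSheafData.support_bot]; trivial
    have := hJ₁ hgen
    rw [hT, Set.mem_compl_iff, Scheme.mem_regularLocus] at this
    exact this (inferInstanceAs (IsRegularLocalRing X.functionField))
  -- the induction on the set `U` of untreated closed points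
  suffices H : ∀ U : Finset X, (∀ b ∈ U, IsClosed ({b} : Set X)) →
      ∀ (X' : Scheme.{0}) (f : X' ⟶ X) (J : X.IdealSheafData), IsBlowup f J → (J.support : Set X) ⊆ T →
        (∀ x' : X', ¬ IsClosed ({f x'} : Set X) → x' ∈ Scheme.regularLocus X') →
        (∀ x' : X', f x' ∉ U → x' ∈ Scheme.regularLocus X') →
        ∃ (X'' : Scheme.{0}) (f'' : X'' ⟶ X) (J'' : X.IdealSheafData), IsBlowup f'' J'' ∧ J'' ≠ ⊥ ∧
          (J''.support : Set X) ⊆ (Scheme.regularLocus X)ᶜ ∧ Scheme.IsRegular X'' by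
    obtain ⟨X'', f'', J'', hf'', -, hJ'', hreg''⟩ :=
      H F hFcl X' f J hf hJ (fun x' hx' => hreg x' fun h => hx' (hFcl _ h)) hreg
    exact ⟨X'', f'', ⟨J'', hf'', hJ''⟩, hreg''⟩
  intro U
  induction U using Finset.induction with
  | empty =>
    intro _ X' f J hf hJ _ hregU
    exact ⟨X', f, J, hf, hne_of_supp J hJ, hJ, fun x' => (Scheme.mem_regularLocus x').mp (hregU x' (by simp))⟩
  | insert b U hbU ih =>
    intro hcl X' f J hf hJ hregnc hregU
    have hb : IsClosed ({b} : Set X) := hcl b (Finset.mem_insert_self b U)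
    have hclU : ∀ b' ∈ U, IsClosed ({b'} : Set X) := fun b' hb' => hcl b' (Finset.mem_insert_of_mem hb')
    have hJne : J ≠ ⊥ := hne_of_supp J hJ
    haveI : IsProper f := hf.isProper
    haveI : IsLocallyNoetherian X' := LocallyOfFiniteType.isLocallyNoetherian f
    haveI : CompactSpace X' := QuasiCompact.compactSpace_of_compactSpace f
    haveI : IsNoetherian X' := {}
    haveI : IsIntegral X' := hf.isIntegral hJne
    by_cases hbT : b ∉ T
    · -- `b ∈ Reg X`: `f` is an isomorphism over `(Supp J)ᶜ ∋ b`, so `X'` is regular over `b` — nothing to do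
      refine ih hclU X' f J hf hJ hregnc fun x' hx' => ?_
      by_cases hxb : f x' = b
      · have h2 : f x' ∉ (J.support : Set X) := fun h => hbT (hJ (hxb ▸ h))
        haveI := hf.isIso_compl
        have h1 : f x' ∈ Scheme.regularLocus X := by
          rw [hxb]; by_contra h; exact hbT h
        exact (mem_regularLocus_iff_of_isIso_morphismRestrict f ⟨(J.support : Set X)ᶜ, J.support.isClosed.isOpen_compl⟩ x' h2).mpr h1
      · exact hregU x' (by simp [hxb, hx'])
    -- `b ∈ Sing X`, a closed point
    push Not at hbT
    -- the pro-open local scheme `S' = X' ×_X Spec 𝒪_{X,b}`, a blowing up of `Spec 𝒪_{X,b}` (flat base change)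
    haveI : Flat (X.fromSpecStalk b) := flat_fromSpecStalk X b
    haveI : IsNoetherian (pullback f (X.fromSpecStalk b)) := {}
    have hgb : IsBlowup (pullback.snd f (X.fromSpecStalk b)) (J.comap (X.fromSpecStalk b)) :=
      hf.pullback_snd_of_flat (X.fromSpecStalk b)
    have hfj : ∀ s : ↑(pullback f (X.fromSpecStalk b)),
        f (pullback.fst f (X.fromSpecStalk b) s) = X.fromSpecStalk b (pullback.snd f (X.fromSpecStalk b) s) := fun s => by
      rw [← Scheme.Hom.comp_apply, pullback.condition, Scheme.Hom.comp_apply]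
    -- `S'` is regular off the closed fibre: its other points lie over NON-closed generizations of `b`
    have hsing : ∀ s : ↑(pullback f (X.fromSpecStalk b)),
        s ∉ Scheme.regularLocus (pullback f (X.fromSpecStalk b)) →
          (pullback.snd f (X.fromSpecStalk b)).base s = closedPoint (X.presheaf.stalk b) := by
      intro s hs
      by_contra hne
      apply hs
      rw [mem_regularLocus_iff_pullback_fst_fromSpecStalk f b s]
      apply hregnc
      have hyb : f (pullback.fst f (X.fromSpecStalk b) s) ⤳ b := by
        have := Set.mem_range_self (f := pullback.fst f (X.fromSpecStalk b)) s
        rw [range_pullback_fst_fromSpecStalk] at this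
        exact this
      refine not_isClosed_of_specializes_of_ne hyb fun heq => hne ?_
      apply (X.fromSpecStalk b).isEmbedding.injective
      rw [← hfj s, heq, Scheme.fromSpecStalk_closedPoint]
    -- the local centre `J·𝒪` is `Sing(Spec 𝒪_{X,b})`-supported
    have hadm : ((J.comap (X.fromSpecStalk b)).support : Set ↑(Spec (X.presheaf.stalk b))) ⊆
        (Scheme.regularLocus (Spec (X.presheaf.stalk b)))ᶜ :=
      AdmissibleLocalCentre.support_comap_fromSpecStalk_subset J hJ b
    -- Temkin's condition (iii) at the closed singular point `b`: a desingularization `ρ : S'' → S'` along `𝓚 ⊆ Sing S'`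
    obtain ⟨S'', ρ, hdes⟩ := hloc b hb hbT
      (pullback f (X.fromSpecStalk b)) (pullback.snd f (X.fromSpecStalk b)) (J.comap (X.fromSpecStalk b)) hgb hadm hsing
    obtain ⟨𝓚, hρ, h𝓚s⟩ := hdes.exists_isBlowup
    have hS''reg := hdes.isRegular
    -- its centre is fibre-supported
    have h𝓚fib : ∀ s ∈ (𝓚.support : Set ↑(pullback f (X.fromSpecStalk b))),
        (pullback.snd f (X.fromSpecStalk b)).base s = closedPoint (X.presheaf.stalk b) := fun s hs => hsing s (h𝓚s hs)
    -- extend the centre to `X'` (Lemma 2.1.1) and blow `X'` up along the extension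
    obtain ⟨J', hJ'𝓚, hJ'supp⟩ := exists_idealSheaf_extension_fromSpecStalk f b 𝓚
    obtain ⟨X'', f', hf'⟩ := exists_isBlowup X' J'
    -- the new centre lies over `b`
    have h𝓚b : ∀ s ∈ (𝓚.support : Set ↑(pullback f (X.fromSpecStalk b))), f (pullback.fst f (X.fromSpecStalk b) s) = b := by
      intro s hs
      rw [hfj s, h𝓚fib s hs, Scheme.fromSpecStalk_closedPoint]
    have hJ'b : f '' (J'.support : Set X') ⊆ {b} := by
      rw [hJ'supp]
      refine (image_closure_subset_closure_image f.continuous).trans ?_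
      refine hb.closure_subset_iff.mpr ?_
      rintro _ ⟨_, ⟨s, hs, rfl⟩, rfl⟩
      exact h𝓚b s hs
    have hJ'T : (J'.support : Set X') ⊆ f ⁻¹' T := fun x' hx' => by
      have : f x' = b := hJ'b ⟨x', hx', rfl⟩
      show f x' ∈ T
      rw [this]; exact hbT
    -- so the composite is a `T`-supported blow-up of `X` (Lemma 2.1.4 / Stacks 080B)
    obtain ⟨J₂, hf₂, hJ₂⟩ := hf.exists_isBlowup_comp_supported f J f' J' T hJ hf' hJ'T
    haveI : IsProper f' := hf'.isProper
    -- apply the induction hypothesis to the new model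
    refine ih hclU X'' (f' ≫ f) J₂ hf₂ hJ₂ (fun x'' hx'' => ?_) (fun x'' hx'' => ?_)
    · -- regular over NON-closed points: there `f'` is an isomorphism (the centre lies over the closed point `b`)
      rw [Scheme.Hom.comp_apply] at hx''
      have h2 : f' x'' ∉ (J'.support : Set X') := fun h => by
        have : f (f' x'') = b := hJ'b ⟨_, h, rfl⟩
        exact hx'' (this ▸ hb)
      haveI := hf'.isIso_compl
      exact (mem_regularLocus_iff_of_isIso_morphismRestrict f' ⟨(J'.support : Set X')ᶜ, J'.support.isClosed.isOpen_compl⟩ x'' h2).mpr (hregnc _ hx'')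
    · rw [Scheme.Hom.comp_apply] at hx''
      by_cases hxb : f (f' x'') = b
      · -- over `b`: `X'' ×_{X'} S'` is a blowing up of `S'` along `𝓚`, isomorphic to the regular `S''`; pro-open stalk isomorphisms
        have hs : f' x'' ∈ Set.range (pullback.fst f (X.fromSpecStalk b)) := mem_range_pullback_fst_fromSpecStalk_of_eq f b hxb
        have hT'' : IsBlowup (pullback.snd f' (pullback.fst f (X.fromSpecStalk b))) 𝓚 := by
          rw [← hJ'𝓚]
          exact hf'.pullback_snd_of_flat _
        obtain ⟨e, -, -⟩ := hT''.unique hρ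
        have hx''range : x'' ∈ Set.range (pullback.fst f' (pullback.fst f (X.fromSpecStalk b))) := by
          rw [Scheme.Pullback.range_fst]
          exact hs
        obtain ⟨t, rfl⟩ := hx''range
        refine (mem_regularLocus_iff_of_flat_of_isPreimmersion _ t).mp ?_
        exact (mem_regularLocus_iff_of_flat_of_isPreimmersion e.hom t).mpr (hS''reg _)
      · -- elsewhere: `f'` is an isomorphism near `x''`, and `X'` was regular there
        have h2 : f' x'' ∉ (J'.support : Set X') := fun h => hxb (hJ'b ⟨_, h, rfl⟩)
        haveI := hf'.isIso_compl
        have hx'U : f (f' x'') ∉ insert b U := by simp [hxb, hx'']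
        exact (mem_regularLocus_iff_of_isIso_morphismRestrict f' ⟨(J'.support : Set X')ᶜ, J'.support.isClosed.isOpen_compl⟩ x'' h2).mpr
          (hregU (f' x'') (by simpa using hx'U))

/-! ## §2 `ResolutionTr` from the T-half (per variety), and the calibration both ways -/

/-- ★★ **`ResolutionTr p e r` ⟸ the lower rungs `T(p,e′,r′)` (`4 ≤ e′ < e`, `r′ ≥ 1`) and `T(p,e,r)` itself**, modulo {CP 1.1, 081R, CP 4.4} (`e ≥ 4`): for ONE integral
separated finite-type `e`-fold `Y` over `K = k(X₁,…,X_r)`, `DimSlice.regularOffFinite_of_rungs` (non-closed points: the lower rungs and Cossart–Piltant) gives a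
`Sing Y`-supported blowing up regular off finitely many closed points, and §1 finishes with `T(p,e,r)` at the closed points of `Y` (the field `k(X₁,…,X_r)` IS the
`K` of the rung). [OURS · conditional-result] [cite: Temkin2008, Prop. 2.3.4] [cite: CossartPiltant2019, Thm. 1.1 (i)(ii); Prop. 4.4] [cite: RaynaudGruson1971, Thm. 5.2.2] -/
theorem resolutionTr_of_tr {p e r : ℕ} (h4 : 4 ≤ e)
    (hG : CossartPiltant2019General.{0}) (h081R : Stacks081R.{0}) (hP : CossartPiltant2019Principalization.{0})
    (hRlt : ∀ e' r' : ℕ, 4 ≤ e' → e' + 1 ≤ e → 1 ≤ r' → ClosedPointLocalResolutionAdmTr p e' r')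
    (hT : ClosedPointLocalResolutionAdmTr p e r) : ResolutionTr p e r := by
  classical
  intro k _ _ Y g hs hl hq hi hd
  haveI := hs; haveI := hl; haveI := hq
  haveI := NonClosedPointChart.charP_fractionRing_mvPolynomial p k r
  obtain ⟨X', f, J, F, hf, hJ, -, hFfin, hFcl, hreg⟩ :=
    DimSlice.regularOffFinite_of_rungs hG h081R hP p _ Y g hd (by omega) hRlt
  refine admitsDesingularization_of_regularOffFinite_of_localRes Y g (fun b hb _ S' g' I hg' hI hfib => ?_) X' f J hf hJ hFfin.toFinset
    (fun b hb => hFcl b (hFfin.mem_toFinset.mp hb)) (fun x' hx' => hreg x' fun h => hx' (hFfin.mem_toFinset.mpr h))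
  exact hT k Y g hs hl hq hi hd b hb S' g' I hg' hI hfib

/-- ★★★ **THE CALIBRATION: `ResolutionTr p e r ↔ ClosedPointLocalResolutionAdmTr p e r`** given {CP 1.1, 081R, CP 4.4} and the lower rungs `T(p,e′,r′)`, `4 ≤ e′ < e`,
`r′ ≥ 1` (`e ≥ 4`). Door v38's resolution-side stub at level `e` IS resolution — in Temkin's one-blow-up form `Scheme.AdmitsDesingularization` — of integral separated
finite-type `e`-folds over `k(X₁,…,X_r)`: RESOLUTION strength, not local-uniformization strength. [OURS · conditional-result] [cite: Temkin2008, Prop. 2.3.4]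
[cite: CossartPiltant2019, Thm. 1.1 (i)(ii); Prop. 4.4] -/
theorem resolutionTr_iff_tr {p e r : ℕ} (h4 : 4 ≤ e)
    (hG : CossartPiltant2019General.{0}) (h081R : Stacks081R.{0}) (hP : CossartPiltant2019Principalization.{0})
    (hRlt : ∀ e' r' : ℕ, 4 ≤ e' → e' + 1 ≤ e → 1 ≤ r' → ClosedPointLocalResolutionAdmTr p e' r') :
    ResolutionTr p e r ↔ ClosedPointLocalResolutionAdmTr p e r :=
  ⟨closedPointLocalResolutionAdmTr_of_resolutionTr, resolutionTr_of_tr h4 hG h081R hP hRlt⟩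

/-- ★★★ **At the first open level no lower rung is consumed: `ResolutionTr p 4 r ↔ ClosedPointLocalResolutionAdmTr p 4 r`** modulo {CP 1.1, 081R, CP 4.4} — «T(p,4,1)
IS resolution of 4-folds over k(s)». [OURS · conditional-result] [cite: Temkin2008, Prop. 2.3.4] [cite: CossartPiltant2019, Thm. 1.1 (i)(ii); Prop. 4.4] -/
theorem resolutionTr_four_iff_tr_four {p r : ℕ}
    (hG : CossartPiltant2019General.{0}) (h081R : Stacks081R.{0}) (hP : CossartPiltant2019Principalization.{0}) :
    ResolutionTr p 4 r ↔ ClosedPointLocalResolutionAdmTr p 4 r :=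
  resolutionTr_iff_tr le_rfl hG h081R hP fun e' r' h4' hlt _ => absurd hlt (by omega)

/-- ★★ **The families coincide: `(∀ 4 ≤ e ≤ n, r ≥ 1: ResolutionTr p e r) ↔ (∀ 4 ≤ e ≤ n, r ≥ 1: T(p,e,r))`** modulo the threefold package — door v38's stub
`stub_closedPointLocalResolutionAdmTr` (all `e ≥ 4`, `r ≥ 1`) is, level by level, resolution of `e`-folds over the fields `k(X₁,…,X_r)`. [OURS · conditional-result]
[cite: Temkin2008, Prop. 2.3.4] [cite: CossartPiltant2019, Thm. 1.1 (i)(ii); Prop. 4.4] -/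
theorem forall_resolutionTr_iff_forall_tr (p n : ℕ)
    (hG : CossartPiltant2019General.{0}) (h081R : Stacks081R.{0}) (hP : CossartPiltant2019Principalization.{0}) :
    (∀ e r : ℕ, 4 ≤ e → e ≤ n → 1 ≤ r → ResolutionTr p e r) ↔ (∀ e r : ℕ, 4 ≤ e → e ≤ n → 1 ≤ r → ClosedPointLocalResolutionAdmTr p e r) := by
  refine ⟨fun h e r he hen hr => closedPointLocalResolutionAdmTr_of_resolutionTr (h e r he hen hr), fun h e r he hen hr => ?_⟩
  exact resolutionTr_of_tr he hG h081R hP (fun e' r' h4' hlt hr' => h e' r' h4' (by omega) hr') (h e r he hen hr)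

/-- **Door v38's stub ⟺ the resolution rungs** (all `e ≥ 4`, `r ≥ 1`), modulo the threefold package. [OURS · conditional-result] [cite: Temkin2008, Prop. 2.3.4] -/
theorem stubTr_iff_resolutionTr
    (hG : CossartPiltant2019General.{0}) (h081R : Stacks081R.{0}) (hP : CossartPiltant2019Principalization.{0}) :
    (∀ p e r : ℕ, p.Prime → 4 ≤ e → 1 ≤ r → ClosedPointLocalResolutionAdmTr p e r) ↔
      (∀ p e r : ℕ, p.Prime → 4 ≤ e → 1 ≤ r → ResolutionTr p e r) := by
  refine ⟨fun h p e r hp he hr => ?_, fun h p e r hp he hr => closedPointLocalResolutionAdmTr_of_resolutionTr (h p e r hp he hr)⟩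
  exact resolutionTr_of_tr he hG h081R hP (fun e' r' h4' _ hr' => h p e' r' hp h4' hr') (h p e r hp he hr)

end Summit.ResolutionOfSingularities.ResolutionOfSingularities.Theorems.FInjectiveMacaulayfication.ResolutionOfTr

end
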